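import Summits.AtomisticToContinuum.HydrodynamicLimit.Theorems.JaynesSqueezeHardSphereLDAPathStep
import Summits.AtomisticToContinuum.HydrodynamicLimit.Theorems.JaynesSqueezeHardSphereLDAPathSums
import HarnessLib

/-!
# Hard-sphere local density approximation, VI: the free energy at the thermodynamic activity (continuous profiles)

Helper file for the support item `HardSphereLDA` (stmt-AtomisticToContinuum-13459) of route
`JaynesSqueeze`: clause (B1) of the item for CONTINUOUS density profiles.

`tendsto_freeEnergy_continuous` — under the low-density equation of state (`HsEosLowDensity`:
analytic `F` with `f_ex = F` on `[0, η₀)` and the canonical thermodynamic limit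
`−N⁻¹ log hsFreeVolume η N → F(η)`) and the insertion-factor package of the tree
(`insertionFactor_package`), there is a packing threshold `η_s > 0` such that for every `σ > 0` and
every continuous density `ρ > 0` on `𝕋³` of unit mass with `ρσ³ ≤ η_s`, the canonical free energy
per particle of `N + 1` spheres of diameter `σ(N+1)^{-1/3}` in the field of the thermodynamic activity
`α_σ(ρ) = ρ e^{g_σ(ρ)}` converges:

  `(N+1)⁻¹ log Z_N(α_σ(ρ)) → ∫ ρ · ρσ³ f_ex′(ρσ³) dx`.

Proof: along the linear density path `ρ_t = (1−t) + tρ` (file V) the increments of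
`Λ_N = (N+1)⁻¹ log Z_N` are sandwiched, eventually in `N`, by the Stieltjes sums of the field
increments against the node densities (file IV: convexity + the mean one-point limit at the inverted
activities), and both sums are within `O(1/m)` of `∫ [Ψ_σ(ρ) − Ψ_σ(1)]`, `Ψ_σ(r) = r + v_σ(r)`,
`v_σ(r) = r·rσ³f_ex′(rσ³)` (file V); the uniform gas contributes `Λ_N(1) → g_σ(1) − F(σ³) = v_σ(1)`
(file III), and `∫(ρ − 1) = 0`. No definitions. prover-pitem-stmt-AtomisticToContinuum-13459-0.
-/

noncomputable section

namespace Summit.AtomisticToContinuum.HydrodynamicLimit.Theorems.HardSphereLDA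

open MeasureTheory Filter Set Topology
open scoped ENNReal
open Literature.MathematicalPhysics.KineticTheory Literature.Analysis.FluidPDE
open Summit.AtomisticToContinuum.HydrodynamicLimit.Theorems.KineticWindowGronwallActivityInversion

/-! ### Small facts -/

/-- A unit-mass continuous density on `𝕋³` reaches `1`: `∃ x, 1 ≤ ρ(x)`. [folklore] -/
theorem exists_one_le_of_integral_eq_one {ρ : T3 → ℝ} (hρc : Continuous ρ) (hρ1 : (∫ x, ρ x) = 1) :
    ∃ x, 1 ≤ ρ x := by
  by_contra hcon
  push Not at hcon
  have hpos : 0 < ∫ x, (1 - ρ x) := by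
    rw [integral_pos_iff_support_of_nonneg (fun x => sub_nonneg.2 (hcon x).le)
      ((integrable_const 1).sub (integrable_of_continuous_T3 hρc))]
    have hsupp : Function.support (fun x => 1 - ρ x) = univ :=
      eq_univ_of_forall fun x => (sub_pos.2 (hcon x)).ne'
    rw [hsupp, measure_univ]
    exact one_pos
  rw [integral_sub (integrable_const 1) (integrable_of_continuous_T3 hρc), integral_const, smul_eq_mul,
    probReal_univ, hρ1] at hpos
  linarith

/-- Composition with a continuous map of a function differentiable along the range is continuous.
[folklore] -/
theorem continuous_comp_of_hasDerivAt {ρ : T3 → ℝ} (hρc : Continuous ρ) {f f' : ℝ → ℝ}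
    (hf : ∀ x, HasDerivAt f (f' (ρ x)) (ρ x)) : Continuous fun x => f (ρ x) :=
  continuous_iff_continuousAt.2 fun x => (hf x).continuousAt.comp hρc.continuousAt

/-- Scaling the activity by a constant scales the position weight: `W(c a) = cⁿ W(a)`. [folklore] -/
theorem posWeight_const_mul (c : ℝ) (a : T3 → ℝ) (ε : ℝ) (n : ℕ) (x : Fin n → T3) :
    posWeight (fun y => c * a y) ε n x = c ^ n * posWeight a ε n x := by
  unfold posWeight
  by_cases hx : x ∈ posDomain ε n
  · simp only [indicator_of_mem hx, Finset.prod_mul_distrib, Finset.prod_const, Finset.card_univ,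
      Fintype.card_fin]
  · simp only [indicator_of_notMem hx, mul_zero]

/-- Scaling the activity by a constant scales the partition function: `Z(c a) = cⁿ Z(a)`. [folklore] -/
theorem posPartition_const_mul (c : ℝ) (a : T3 → ℝ) (ε : ℝ) (n : ℕ) :
    posPartition (fun y => c * a y) ε n = c ^ n * posPartition a ε n := by
  rw [posPartition, posPartition, ← integral_const_mul]
  exact integral_congr_ae (Eventually.of_forall fun x => posWeight_const_mul c a ε n x)

/-- The thermodynamic activities of two positive densities differ by the exponential of the
difference of the local chemical potentials `h_σ = log + g_σ`. [folklore] -/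
theorem thermoActivity_eq_mul_exp (σ : ℝ) {ρA ρB : T3 → ℝ} (hA0 : ∀ x, 0 < ρA x) (hB0 : ∀ x, 0 < ρB x)
    (x : T3) :
    thermoActivity σ ρB x = thermoActivity σ ρA x * Real.exp
      ((Real.log (ρB x) + (hsExcessFreeEnergy (ρB x * σ ^ 3) + ρB x * σ ^ 3 *
          deriv hsExcessFreeEnergy (ρB x * σ ^ 3))) -
        (Real.log (ρA x) + (hsExcessFreeEnergy (ρA x * σ ^ 3) + ρA x * σ ^ 3 *
          deriv hsExcessFreeEnergy (ρA x * σ ^ 3)))) := by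
  unfold thermoActivity
  rw [Real.exp_sub, Real.exp_add (Real.log (ρB x)), Real.exp_add (Real.log (ρA x)), Real.exp_log (hA0 x),
    Real.exp_log (hB0 x)]
  have h1 : Real.exp (hsExcessFreeEnergy (ρA x * σ ^ 3) + ρA x * σ ^ 3 * deriv hsExcessFreeEnergy (ρA x * σ ^ 3)) ≠ 0 :=
    (Real.exp_pos _).ne'
  have h2 : ρA x ≠ 0 := (hA0 x).ne'
  field_simp

/-! ### The free energy at the thermodynamic activity: continuous profiles -/

section Core

variable {η₀ : ℝ} {F : ℝ → ℝ} (hη₀ : 0 < η₀) (hFa : AnalyticOnNhd ℝ F (Ioo (-η₀) η₀))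
  (hEq : EqOn hsExcessFreeEnergy F (Ico 0 η₀))
  (hfree : ∀ η ∈ Ico 0 η₀, Tendsto (fun N : ℕ => -(N : ℝ)⁻¹ * Real.log (hsFreeVolume η N)) atTop (𝓝 (F η)))
  {r : ℝ} {Rf : ℝ → ℝ} {η₂ : ℝ} (hr : 0 < r)
  (hsol : ∀ x ∈ Ioo (-r) r, 0 < Rf x ∧ Rf x * (∑' j : ℕ, bE j / (j.factorial : ℝ) * (x * Rf x) ^ j) = 1)
  (hbd : ∀ x ∈ Icc 0 r, 1 ≤ Rf x ∧ Rf x ≤ 2) (hcont : ContinuousOn Rf (Icc 0 r))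
  (huniq : ∀ x ∈ Ioo (-r) r, ∀ R ∈ Icc (1 / 2 : ℝ) 2,
    R * (∑' j : ℕ, bE j / (j.factorial : ℝ) * (x * R) ^ j) = 1 → R = Rf x)
  (hη₂ : 0 < η₂)
  (hexp : ∀ η ∈ Ioo 0 η₂, Real.exp (hsExcessFreeEnergy η + η * deriv hsExcessFreeEnergy η) = Rf η)
include hη₀ hFa hEq hfree hr hsol hbd hcont huniq hη₂ hexp

/-- **CLAUSE (B1) FOR CONTINUOUS PROFILES.** Under `HsEosLowDensity` (analytic `F`, `f_ex = F` on
`[0, η₀)`, canonical thermodynamic limit of the free volume) and the insertion-factor package, there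
is `η_s > 0` such that for all `σ > 0` and all continuous unit-mass densities `ρ > 0` with
`ρσ³ ≤ η_s`: `(N+1)⁻¹ log Z_N(α_σ(ρ)) → ∫ ρ · ρσ³ f_ex′(ρσ³)`. [folklore] -/
theorem tendsto_freeEnergy_continuous :
    ∃ ηs : ℝ, 0 < ηs ∧ ∀ σ : ℝ, 0 < σ → ∀ ρ : T3 → ℝ, Continuous ρ → (∀ x, 0 < ρ x) →
      (∫ x, ρ x) = 1 → (∀ x, ρ x * σ ^ 3 ≤ ηs) →
      Tendsto (fun N : ℕ => (((N + 1 : ℕ) : ℝ))⁻¹ *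
          Real.log (posPartition (thermoActivity σ ρ) (hsDiameter σ N) (N + 1))) atTop
        (𝓝 (∫ x, ρ x * (ρ x * σ ^ 3 * deriv hsExcessFreeEnergy (ρ x * σ ^ 3)))) := by
  obtain ⟨ηc, hηc0, hηcη₀, C, -, hcalc⟩ := eos_calculus hη₀ hFa hEq
  refine ⟨min (thresh r η₂) ηc, lt_min (thresh_pos hr hη₂) hηc0, fun σ hσ ρ hρc hρ0 hρ1 hpack => ?_⟩
  have hσ3 : 0 < σ ^ 3 := pow_pos hσ 3
  have hpackT : ∀ x, ρ x * σ ^ 3 ≤ thresh r η₂ := fun x => (hpack x).trans (min_le_left _ _)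
  obtain ⟨k, k₁, hk⟩ := hcalc σ hσ
  -- the local chemical potential, the free-energy density and `Ψ = id + v`
  set G : ℝ → ℝ := fun s => hsExcessFreeEnergy (s * σ ^ 3) + s * σ ^ 3 * deriv hsExcessFreeEnergy (s * σ ^ 3)
    with hG
  set hg : ℝ → ℝ := fun s => Real.log s + G s with hhg
  set v : ℝ → ℝ := fun s => s * (s * σ ^ 3 * deriv hsExcessFreeEnergy (s * σ ^ 3)) with hv
  set Ψ : ℝ → ℝ := fun s => s + v s with hΨ
  -- `σ³ ≤ η_s`: the density reaches `1`
  obtain ⟨x₁, hx₁⟩ := exists_one_le_of_integral_eq_one hρc hρ1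
  have hσηs : σ ^ 3 ≤ min (thresh r η₂) ηc := by
    have h := hpack x₁
    nlinarith
  have hσηc : σ ^ 3 ≤ ηc := hσηs.trans (min_le_right _ _)
  -- lower and upper bounds of `ρ`
  obtain ⟨x₀, -, hx₀⟩ := isCompact_univ.exists_isMinOn univ_nonempty hρc.continuousOn
  have hmin : ∀ x, ρ x₀ ≤ ρ x := fun x => (isMinOn_iff.1 hx₀) x (mem_univ x)
  set rlo : ℝ := min 1 (ρ x₀) with hrlo
  have hrlo0 : 0 < rlo := lt_min one_pos (hρ0 x₀)
  have hrlo1 : rlo ≤ 1 := min_le_left _ _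
  have hρlo : ∀ x, rlo ≤ ρ x := fun x => (min_le_right _ _).trans (hmin x)
  obtain ⟨Rb, hRb0, hRb⟩ := exists_forall_abs_le_of_continuous hρc
  -- calculus facts on the segments `[[1, ρ x]]`
  have hseg : ∀ x, ∀ s ∈ uIcc 1 (ρ x), 0 < s ∧ s * σ ^ 3 ≤ ηc ∧ rlo ≤ s := by
    intro x s hs
    rcases le_total 1 (ρ x) with h1 | h1
    · rw [uIcc_of_le h1] at hs
      refine ⟨by linarith [hs.1], ?_, hrlo1.trans hs.1⟩
      calc s * σ ^ 3 ≤ ρ x * σ ^ 3 := by nlinarith [hs.2]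
        _ ≤ ηc := (hpack x).trans (min_le_right _ _)
    · rw [uIcc_of_ge h1] at hs
      refine ⟨hrlo0.trans_le ((hρlo x).trans hs.1), ?_, (hρlo x).trans hs.1⟩
      calc s * σ ^ 3 ≤ 1 * σ ^ 3 := by nlinarith [hs.2]
        _ ≤ ηc := by rw [one_mul]; exact hσηc
  have hderiv : ∀ x, ∀ s ∈ uIcc 1 (ρ x), HasDerivAt hg (k s) s ∧ HasDerivAt Ψ (s * k s) s ∧
      |k s| ≤ 3 / (2 * rlo) := by
    intro x s hs
    obtain ⟨hs0, hsc, hslo⟩ := hseg x s hs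
    obtain ⟨-, -, hh, hklo, hkhi, -, -, hvd, -⟩ := hk s hs0 hsc
    refine ⟨hh, ?_, ?_⟩
    · have h := (hasDerivAt_id s).add hvd
      have he : (1 : ℝ) + (s * k s - 1) = s * k s := by ring
      rw [he] at h
      exact h
    · rw [abs_of_pos (lt_of_lt_of_le (by positivity) hklo)]
      calc k s ≤ 3 / (2 * s) := hkhi
        _ ≤ 3 / (2 * rlo) := by gcongr
  set K : ℝ := 3 / (2 * rlo) with hK
  have hK0 : 0 ≤ K := by positivity
  -- continuity of `hg ∘ ρ'` and `v ∘ ρ'` for admissible `ρ'`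
  have hcont_hg : ∀ ρ' : T3 → ℝ, Continuous ρ' → (∀ x, 0 < ρ' x) → (∀ x, ρ' x * σ ^ 3 ≤ ηc) →
      Continuous fun x => hg (ρ' x) := fun ρ' h1 h2 h3 =>
    continuous_comp_of_hasDerivAt (f' := k) h1 fun x => (hk (ρ' x) (h2 x) (h3 x)).2.2.1
  have hcont_v : Continuous fun x => v (ρ x) :=
    continuous_comp_of_hasDerivAt (f' := fun s => s * k s - 1) hρc fun x =>
      (hk (ρ x) (hρ0 x) ((hpack x).trans (min_le_right _ _))).2.2.2.2.2.2.2.1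
  ------------------------------------------------------------------
  -- Step A: the increment from the uniform gas tends to `D = ∫ (Ψ(ρ) - Ψ(1))`
  ------------------------------------------------------------------
  set D : ℝ := ∫ x, (Ψ (ρ x) - Ψ 1) with hD
  have hA : Tendsto (fun N : ℕ => (((N + 1 : ℕ) : ℝ))⁻¹ *
      (Real.log (posPartition (thermoActivity σ ρ) (hsDiameter σ N) (N + 1)) -
        Real.log (posPartition (thermoActivity σ (fun _ => 1)) (hsDiameter σ N) (N + 1)))) atTop (𝓝 D) := by
    rw [Metric.tendsto_atTop]
    intro e he
    -- choose the number of path steps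
    obtain ⟨m, hm⟩ := exists_nat_gt (2 * K * (Rb + 1) ^ 2 / (e / 2))
    have hm0 : 0 < m := by
      have : (0 : ℝ) < m := lt_of_le_of_lt (by positivity) hm
      exact_mod_cast this
    have hm0' : (0 : ℝ) < m := by exact_mod_cast hm0
    have herr : 2 * K * (Rb + 1) ^ 2 / m < e / 2 := by
      rw [div_lt_iff₀ hm0']
      rw [div_lt_iff₀ (by positivity : (0 : ℝ) < e / 2)] at hm
      linarith
    -- the path
    set τ : ℕ → ℝ := fun j => min ((j : ℝ) / m) 1 with hτ
    set ρn : ℕ → T3 → ℝ := fun j x => (1 - τ j) + τ j * ρ x with hρn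
    have hτmem : ∀ j, τ j ∈ Icc (0 : ℝ) 1 := fun j => pathParam_mem m j
    have hnode : ∀ j, Continuous (ρn j) ∧ (∀ x, rlo ≤ ρn j x) ∧ (∀ x, ρn j x ≤ max 1 Rb) ∧
        (∀ x, 0 < ρn j x) ∧ (∫ x, ρn j x) = 1 := fun j =>
      pathNode_spec hρc hρ1 hrlo0 hrlo1 (le_max_left _ _) hρlo
        (fun x => ((le_abs_self _).trans (hRb x)).trans (le_max_right _ _)) (hτmem j)
    have hnode_pack : ∀ j x, ρn j x * σ ^ 3 ≤ min (thresh r η₂) ηc := fun j x =>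
      pathNode_packing hσηs hpack (hτmem j) x
    set ψn : ℕ → T3 → ℝ := fun j x => hg (ρn (j + 1) x) - hg (ρn j x) with hψn
    have hψc : ∀ j, Continuous (ψn j) := fun j =>
      (hcont_hg _ (hnode (j + 1)).1 (hnode (j + 1)).2.2.2.1 fun x => (hnode_pack (j + 1) x).trans (min_le_right _ _)).sub
        (hcont_hg _ (hnode j).1 (hnode j).2.2.2.1 fun x => (hnode_pack j x).trans (min_le_right _ _))
    have hψ : ∀ j x, thermoActivity σ (ρn (j + 1)) x = thermoActivity σ (ρn j) x * Real.exp (ψn j x) :=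
      fun j x => thermoActivity_eq_mul_exp σ (hnode j).2.2.2.1 (hnode (j + 1)).2.2.2.1 x
    have hchain := sandwich_chain hr hsol hbd hcont huniq hη₂ hexp hσ ρn (fun j => (hnode j).1)
      (fun j => (hnode j).2.2.2.1) (fun j => (hnode j).2.2.2.2) (fun j x => (hnode_pack j x).trans (min_le_left _ _))
      ψn hψc hψ m (half_pos he)
    -- endpoints of the path
    have hend : ρn m = ρ := by
      funext x
      rw [hρn, hτ]; dsimp only
      rw [div_self hm0'.ne', min_self]; ring
    have hstart : ρn 0 = fun _ => 1 := by
      funext x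
      rw [hρn, hτ]; dsimp only
      rw [Nat.cast_zero, zero_div, min_eq_left zero_le_one]; ring
    rw [hend, hstart] at hchain
    -- the Stieltjes sums are within `e/2` of `D`
    have hint_n : ∀ j, Integrable (fun x => ψn j x * ρn j x) := fun j =>
      integrable_of_continuous_T3 ((hψc j).mul (hnode j).1)
    have hint_n' : ∀ j, Integrable (fun x => ψn j x * ρn (j + 1) x) := fun j =>
      integrable_of_continuous_T3 ((hψc j).mul (hnode (j + 1)).1)
    have hΨint : Integrable fun x => Ψ (ρ x) - Ψ 1 :=
      ((integrable_of_continuous_T3 hρc).add (integrable_of_continuous_T3 hcont_v)).sub (integrable_const _)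
    have hlow : |(∑ j ∈ Finset.range m, ∫ x, ψn j x * ρn j x) - D| ≤ K * (Rb + 1) ^ 2 / m := by
      rw [← integral_finsetSum _ fun j _ => hint_n j, hD, ← integral_sub (integrable_finsetSum _ fun j _ => hint_n j) hΨint]
      refine (abs_integral_le_integral_abs).trans ?_
      refine (integral_mono_of_nonneg (Eventually.of_forall fun x => abs_nonneg _) (integrable_const _)
        (Eventually.of_forall fun x => ?_)).trans (le_of_eq (by rw [integral_const, smul_eq_mul, probReal_univ, one_mul]))
      dsimp only
      have h1 := abs_lowerSum_sub_le (fun s hs => (hderiv x s hs).1) (fun s hs => (hderiv x s hs).2.1)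
        (fun s hs => (hderiv x s hs).2.2) hm0 (r₁ := ρ x)
      have h2 : (ρ x - 1) ^ 2 ≤ (Rb + 1) ^ 2 := by
        have := hRb x
        rw [abs_le] at this
        nlinarith [hρ0 x]
      calc |(∑ j ∈ Finset.range m, ψn j x * ρn j x) - (Ψ (ρ x) - Ψ 1)|
          = |(∑ j ∈ Finset.range m, ((1 - min ((j : ℝ) / m) 1) + min ((j : ℝ) / m) 1 * ρ x) *
              (hg ((1 - min (((j + 1 : ℕ) : ℝ) / m) 1) + min (((j + 1 : ℕ) : ℝ) / m) 1 * ρ x) -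
                hg ((1 - min ((j : ℝ) / m) 1) + min ((j : ℝ) / m) 1 * ρ x))) - (Ψ (ρ x) - Ψ 1)| := by
            congr 2
            exact Finset.sum_congr rfl fun j _ => by rw [hψn, hρn, hτ]; ring
        _ ≤ K * (ρ x - 1) ^ 2 / m := h1
        _ ≤ K * (Rb + 1) ^ 2 / m := by gcongr
    have hup : |(∑ j ∈ Finset.range m, ∫ x, ψn j x * ρn (j + 1) x) - D| ≤ 2 * K * (Rb + 1) ^ 2 / m := by
      rw [← integral_finsetSum _ fun j _ => hint_n' j, hD, ← integral_sub (integrable_finsetSum _ fun j _ => hint_n' j) hΨint]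
      refine (abs_integral_le_integral_abs).trans ?_
      refine (integral_mono_of_nonneg (Eventually.of_forall fun x => abs_nonneg _) (integrable_const _)
        (Eventually.of_forall fun x => ?_)).trans (le_of_eq (by rw [integral_const, smul_eq_mul, probReal_univ, one_mul]))
      dsimp only
      have h1 := abs_upperSum_sub_le (fun s hs => (hderiv x s hs).1) (fun s hs => (hderiv x s hs).2.1)
        (fun s hs => (hderiv x s hs).2.2) hm0 (r₁ := ρ x)
      have h2 : (ρ x - 1) ^ 2 ≤ (Rb + 1) ^ 2 := by
        have := hRb x
        rw [abs_le] at this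
        nlinarith [hρ0 x]
      calc |(∑ j ∈ Finset.range m, ψn j x * ρn (j + 1) x) - (Ψ (ρ x) - Ψ 1)|
          = |(∑ j ∈ Finset.range m, ((1 - min (((j + 1 : ℕ) : ℝ) / m) 1) + min (((j + 1 : ℕ) : ℝ) / m) 1 * ρ x) *
              (hg ((1 - min (((j + 1 : ℕ) : ℝ) / m) 1) + min (((j + 1 : ℕ) : ℝ) / m) 1 * ρ x) -
                hg ((1 - min ((j : ℝ) / m) 1) + min ((j : ℝ) / m) 1 * ρ x))) - (Ψ (ρ x) - Ψ 1)| := by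
            congr 2
            exact Finset.sum_congr rfl fun j _ => by rw [hψn, hρn, hτ]; ring
        _ ≤ 2 * K * (ρ x - 1) ^ 2 / m := h1
        _ ≤ 2 * K * (Rb + 1) ^ 2 / m := by gcongr
    have hlow' : D - e / 2 < ∑ j ∈ Finset.range m, ∫ x, ψn j x * ρn j x := by
      have := (abs_le.1 hlow).1
      have hKe : K * (Rb + 1) ^ 2 / m < e / 2 := lt_of_le_of_lt (by gcongr; linarith) herr
      linarith
    have hup' : (∑ j ∈ Finset.range m, ∫ x, ψn j x * ρn (j + 1) x) < D + e / 2 := by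
      have := (abs_le.1 hup).2
      linarith
    obtain ⟨N₀, hN₀⟩ := eventually_atTop.1 hchain
    refine ⟨N₀, fun N hN => ?_⟩
    obtain ⟨h1, h2⟩ := hN₀ N hN
    rw [Real.dist_eq, abs_lt]
    constructor <;> linarith
  ------------------------------------------------------------------
  -- Step B: the uniform gas `Λ_N(1) → g(1) - F(σ³) = v(1)`
  ------------------------------------------------------------------
  have hB : Tendsto (fun N : ℕ => (((N + 1 : ℕ) : ℝ))⁻¹ *
      Real.log (posPartition (thermoActivity σ (fun _ => 1)) (hsDiameter σ N) (N + 1))) atTop (𝓝 (v 1)) := by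
    have hone := hk 1 one_pos (by rw [one_mul]; exact hσηc)
    obtain ⟨hf0, -, -⟩ := hone
    have hσI : σ ^ 3 ∈ Ico 0 η₀ := ⟨hσ3.le, hσηc.trans_lt hηcη₀⟩
    have hunif := tendsto_log_posPartition_one hσ.le (hfree _ hσI)
    have hact : thermoActivity σ (fun _ => (1 : ℝ)) = fun _ => Real.exp (G 1) * 1 := by
      funext x
      unfold thermoActivity
      rw [hG]; dsimp only; ring
    have hv1 : v 1 = G 1 + -F (σ ^ 3) := by
      rw [hv, hG]; dsimp only
      simp only [one_mul] at hf0 ⊢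
      rw [hf0]; ring
    rw [hv1]
    have hlim2 := hunif.const_add (G 1)
    refine hlim2.congr' ?_
    filter_upwards with N
    have hZ1 : 0 < posPartition (fun _ => (1 : ℝ)) (hsDiameter σ N) (N + 1) := by
      have hσ2 : σ ≤ 1 / 2 := by
        have h16 : σ ^ 3 ≤ 1 / 16 := (hσηs.trans (min_le_left _ _)).trans
          ((min_le_left _ _).trans (min_le_right _ _))
        by_contra hc
        push Not at hc
        have : (1 / 2 : ℝ) ^ 3 < σ ^ 3 := pow_lt_pow_left₀ hc (by norm_num) (by norm_num)
        nlinarith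
      exact posPartition_pos continuous_const (fun _ => one_pos) hσ2 N
    rw [hact, posPartition_const_mul, Real.log_mul (pow_pos (Real.exp_pos _) _).ne' hZ1.ne', Real.log_pow,
      Real.log_exp, mul_add, ← mul_assoc, inv_mul_cancel₀ (by positivity), one_mul]
  ------------------------------------------------------------------
  -- Step C: combine, `D + v(1) = ∫ v(ρ)`
  ------------------------------------------------------------------
  have hC := hA.add hB
  have hDv : D + v 1 = ∫ x, ρ x * (ρ x * σ ^ 3 * deriv hsExcessFreeEnergy (ρ x * σ ^ 3)) := by
    rw [hD, hΨ]; dsimp only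
    have h1 : (fun x => ρ x + v (ρ x) - (1 + v 1)) = fun x => (ρ x - 1) + (v (ρ x) - v 1) := by
      funext x; ring
    have i1 : Integrable (fun x => ρ x - 1) := (integrable_of_continuous_T3 hρc).sub (integrable_const _)
    have i2 : Integrable (fun x => v (ρ x) - v 1) := (integrable_of_continuous_T3 hcont_v).sub (integrable_const _)
    rw [h1, integral_add i1 i2, integral_sub (integrable_of_continuous_T3 hρc) (integrable_const _),
      integral_sub (integrable_of_continuous_T3 hcont_v) (integrable_const _), hρ1, integral_const,
      integral_const, smul_eq_mul, smul_eq_mul, probReal_univ]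
    rw [hv]
    ring
  rw [← hDv]
  refine hC.congr fun N => ?_
  ring

end Core

end Summit.AtomisticToContinuum.HydrodynamicLimit.Theorems.HardSphereLDA

end
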